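import Literature.NumberTheory.ConnesMoscovici2022.UVProlateGreenSolutions
import Literature.NumberTheory.ConnesMoscovici2022.UVProlateGreenFormula
import Literature.NumberTheory.ConnesMoscovici2022.UVProlateDeficiencyIndices
import Literature.NumberTheory.ConnesMoscovici2022.UVProlateBoundaryFunctional
import Literature.NumberTheory.ConnesMoscovici2022.UVProlateSpectrumBothSides
import Literature.NumberTheory.ConnesMoscovici2022.UVProlateSADomain
import Literature.Analysis.UnboundedOperators.CompactResolventOfRightInverse
import Literature.Analysis.OperatorTheory.L2KernelHilbertSchmidt
import Literature.Analysis.OperatorTheory.L2KernelOperator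
import Literature.Analysis.OperatorTheory.SupNormCompactOperator
import HarnessLib

/-!
# Connes–Moscovici 2022, Thm 1.6 (iv), operator half: every self-adjoint realisation of the
# prolate wave operator has COMPACT RESOLVENT (Green's kernel of `W_max − z` + finite deficiency)

LINE 1 — FRAMING. RH-FREE corpus literature (spectral theory of the prolate wave operator
`W_λ = −∂(λ² − x²)∂ + (2πλx)²` on `L²(ℝ)`; sequel row O2 of the Connes–Consani corpus, no leaf / binder
role).  bears_on: LADDER-RH W-C/W-P.  WHAT THIS IS NOT: any claim about RH; nothing in this file
mentions `RiemannHypothesis` or bears on the truth of RH.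

[ConnesMoscovici2022, Thm 1.6 (iv)] (= arXiv:2112.05500 Thm 2.6 (iv)): "The spectrum of `W_sa` is
discrete and unbounded on both sides."  THIS FILE proves the OPERATOR HALF in the strong form
**`isCompactOperator_resolvent_of_le_prolateMax`: for every self-adjoint `W ≤ W_max` (in particular
the realisation `W_sa` of the printed boundary conditions, once it is known to be self-adjoint —
clause (i)) and every non-real `z`, the resolvent `(W − z)⁻¹` is a compact operator.**  With the tree's
`exists_hilbertBasis_nat_eigenvectors_of_compact_resolvent` (rh-crit-cc-t9) this gives an orthonormal
eigenbasis with `|μ_n| → ∞`; the sign clause "on both sides" is separate (rh-crit-cc-t12).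

Route (Reed–Simon IV §XIII.14 pattern; the printed proof is one sentence): by
`isCompactOperator_resolvent_of_rightInverse` (tree) and `dim Ker(W_max − z) = 4`
(`finrank_eigenspace_prolateMax`, rh-crit-cc-t8) it suffices to produce ONE compact right inverse
`R₀` of `W_max − z` (`exists_compact_rightInverse`).  `R₀ = R_{(−∞,−λ)} + R_{(−λ,λ)} + R_{(λ,∞)}`,
where on each component `J` the operator `R_J` is the `L²`-KERNEL (Hilbert–Schmidt, hence compact:
`isCompactOperator_of_l2Kernel`) operator with the variation-of-parameters kernel
`−ω_J⁻¹ u_J(x ∧ y) v_J(x ∨ y) 1_J(x) 1_J(y)` built from the Green pairs of `UVProlateGreenSolutions`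
(`u_J` regular at the left singular end, `v_J` at the right one; square integrable by the limit-circle
package `UVProlateDeficiencyEndpoints`, rh-crit-cc-t10).  On `J`, `R_J f = h` solves `(W − z) h = f`
classically (`UVProlateGreenFormula`), and the Green boundary terms `θ · p h′ − p θ′ · h` vanish at
the finite singular ends (the regular choices give `p h′ → 0` and `(x ∓ λ) h → 0`) and at `±∞`
(`prolate_decay_atTop/atBot` + Schwartz decay); so `∫ (Wθ)(R_J f) = ∫ θ (z R_J f + 1_J f)` for every
Schwartz `θ`, and `R₀ f ∈ dom W_max` with `W_max R₀ f = z R₀ f + f` by the weak characterisation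
`exists_prolateMax_eq_of_forall_integral` (rh-crit-cc-t14).

§7 composes with `UVProlateSpectrumBothSides` (rh-crit-cc-t12): clause (iv) of Thm 1.6 holds for every
self-adjoint `W ≤ W_max`, in particular for `W_sa = prolateSA λ` GIVEN clause (i)
(`hasDiscreteSpectrumUnboundedBothSides_prolateSA`).

0 `def`s, 0 named facts, no `sorry`.

## References
* [ConnesMoscovici2022] A. Connes, H. Moscovici, *The UV prolate spectrum matches the zeros of zeta*,
  PNAS 119 (2022) = arXiv:2112.05500, §1 eqs. (1.2), (1.5)–(1.6), Lemma 1.1, Thm 1.6 (held text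
  `paper-arxiv-2112.05500`, chunks p0004–p0006).
* [ReedSimonIV1978] M. Reed, B. Simon, *Methods of Modern Mathematical Physics IV* (1978), §XIII.14,
  Thm XIII.64.
* [ReedSimonI1980] M. Reed, B. Simon, *Methods of Modern Mathematical Physics I* (1980), Thm VI.22–23.
-/

noncomputable section

open Complex Set MeasureTheory Filter intervalIntegral SchwartzMap Function
open scoped Real Topology InnerProductSpace ComplexConjugate

namespace Literature.NumberTheory.ConnesMoscovici2022

open Literature.Analysis.OperatorTheory Literature.Analysis.UnboundedOperators

variable {lam : ℝ} {z : ℂ}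

/-! ## §1 Hilbert–Schmidt compactness of a complex `L²`-kernel operator on `L²(ℝ)` -/

section HS

/-- **An operator on `L²(ℝ)` given a.e. by a square-integrable kernel is compact** (Hilbert–Schmidt;
row-wise Bessel `Σᵢ |⟪K(x,·)̄, eᵢ⟫|² ≤ ‖K(x,·)‖²` integrated in `x`, then the tree's
`isCompactOperator_of_orthonormal_sum_sq_le`). [cite: ReedSimonI1980, Thm. VI.22–VI.23] -/
theorem isCompactOperator_of_l2Kernel {K : ℝ → ℝ → ℂ}
    (hK : MemLp (uncurry K) 2 ((volume : Measure ℝ).prod volume)) {A : L2R →L[ℂ] L2R}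
    (hA : ∀ φ : L2R, (A φ : ℝ → ℂ) =ᵐ[volume] fun x ↦ ∫ y, K x y * φ y) : IsCompactOperator A := by
  refine isCompactOperator_of_orthonormal_sum_sq_le A (C := ∫ x, ∫ y, ‖K x y‖ ^ 2) ?_
  intro m e he
  have hsq : ∀ i, ‖A (e i)‖ ^ 2 = ∫ x, ‖∫ y, K x y * e i y‖ ^ 2 := fun i ↦ by
    rw [norm_Lp_sq_eq_integral]
    refine integral_congr_ae ?_
    filter_upwards [hA (e i)] with x hx
    rw [hx]
  have hint : ∀ i, Integrable (fun x ↦ ‖∫ y, K x y * e i y‖ ^ 2) := fun i ↦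
    (L2Kernel.memLp_two_integral_mul hK (e i)).integrable_norm_pow two_ne_zero
  simp only [hsq]
  rw [← integral_finsetSum _ fun i _ ↦ hint i]
  refine integral_mono_ae (integrable_finsetSum _ fun i _ ↦ hint i)
    (L2Kernel.integrable_integral_norm_sq hK) ?_
  filter_upwards [L2Kernel.ae_memLp_section hK] with x hx
  -- row-wise Bessel
  have hk := L2Kernel.norm_toLp_conj_section_sq hx
  calc ∑ i, ‖∫ y, K x y * e i y‖ ^ 2
      = ∑ i, ‖⟪e i, (L2Kernel.memLp_two_conj_section hx).toLp _⟫_ℂ‖ ^ 2 := by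
        refine Finset.sum_congr rfl fun i _ ↦ ?_
        rw [L2Kernel.integral_mul_eq_inner hx, norm_inner_symm]
    _ ≤ ‖(L2Kernel.memLp_two_conj_section hx).toLp _‖ ^ 2 := he.sum_inner_products_le _
    _ = ∫ y, ‖K x y‖ ^ 2 := hk

end HS

/-! ## §2 The Green's kernel of a pair `(ũ, ṽ)` of square-integrable functions -/

section Kernel

variable {ut vt : ℝ → ℂ} {ω : ℂ}

/-- The Green's kernel `K(x, y) = −ω⁻¹ (ṽ(x) ũ(y) 1_{y ≤ x} + ũ(x) ṽ(y) 1_{x < y})` of two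
`L²(ℝ)` functions is square integrable on `ℝ × ℝ`
(`|K|² ≤ 2|ω|⁻² (|ṽ(x)|²|ũ(y)|² + |ũ(x)|²|ṽ(y)|²)`).
[cite: ReedSimonIV1978, §XIII.14 (Green's function of a Sturm–Liouville operator with `L²` solutions)] -/
theorem memLp_greenKernel (hu : MemLp ut 2 volume) (hv : MemLp vt 2 volume) (ω : ℂ) :
    MemLp (uncurry fun x y ↦ -ω⁻¹ * (if y ≤ x then vt x * ut y else ut x * vt y)) 2
      ((volume : Measure ℝ).prod volume) := by
  set s : Set (ℝ × ℝ) := {q | q.2 ≤ q.1} with hs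
  have hsm : MeasurableSet s := measurableSet_le measurable_snd measurable_fst
  have hmeas : AEStronglyMeasurable
      (uncurry fun x y ↦ -ω⁻¹ * (if y ≤ x then vt x * ut y else ut x * vt y))
      ((volume : Measure ℝ).prod volume) := by
    have h1 : AEStronglyMeasurable (fun q : ℝ × ℝ ↦ vt q.1 * ut q.2) ((volume : Measure ℝ).prod volume) :=
      hv.1.comp_fst.mul hu.1.comp_snd
    have h2 : AEStronglyMeasurable (fun q : ℝ × ℝ ↦ ut q.1 * vt q.2) ((volume : Measure ℝ).prod volume) :=
      hu.1.comp_fst.mul hv.1.comp_snd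
    have h3 : AEStronglyMeasurable (s.piecewise (fun q : ℝ × ℝ ↦ vt q.1 * ut q.2)
        (fun q : ℝ × ℝ ↦ ut q.1 * vt q.2)) ((volume : Measure ℝ).prod volume) :=
      h1.restrict.piecewise hsm h2.restrict
    refine ((aestronglyMeasurable_const (b := -ω⁻¹)).mul h3).congr (Eventually.of_forall fun q ↦ ?_)
    simp only [uncurry, Set.piecewise, hs, mem_setOf_eq, Pi.mul_apply]
  rw [memLp_two_iff_integrable_sq_norm hmeas]
  have hdom : Integrable (fun q : ℝ × ℝ ↦ 2 * ‖ω⁻¹‖ ^ 2 *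
      (‖vt q.1‖ ^ 2 * ‖ut q.2‖ ^ 2 + ‖ut q.1‖ ^ 2 * ‖vt q.2‖ ^ 2)) ((volume : Measure ℝ).prod volume) :=
    ((L2Kernel.integrable_norm_sq_mul_norm_sq hv hu).add
      (L2Kernel.integrable_norm_sq_mul_norm_sq hu hv)).const_mul _
  refine hdom.mono' (hmeas.norm.pow 2) (Eventually.of_forall fun q ↦ ?_)
  simp only [uncurry, norm_pow, norm_norm]
  have hb : ‖-ω⁻¹ * (if q.2 ≤ q.1 then vt q.1 * ut q.2 else ut q.1 * vt q.2)‖ ≤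
      ‖ω⁻¹‖ * (‖vt q.1‖ * ‖ut q.2‖ + ‖ut q.1‖ * ‖vt q.2‖) := by
    rw [norm_mul, norm_neg]
    gcongr
    split_ifs
    · rw [norm_mul]; linarith [mul_nonneg (norm_nonneg (ut q.1)) (norm_nonneg (vt q.2))]
    · rw [norm_mul]; linarith [mul_nonneg (norm_nonneg (vt q.1)) (norm_nonneg (ut q.2))]
  have h0 : 0 ≤ ‖-ω⁻¹ * (if q.2 ≤ q.1 then vt q.1 * ut q.2 else ut q.1 * vt q.2)‖ := norm_nonneg _
  calc ‖-ω⁻¹ * (if q.2 ≤ q.1 then vt q.1 * ut q.2 else ut q.1 * vt q.2)‖ ^ 2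
      ≤ (‖ω⁻¹‖ * (‖vt q.1‖ * ‖ut q.2‖ + ‖ut q.1‖ * ‖vt q.2‖)) ^ 2 := by gcongr
    _ ≤ 2 * ‖ω⁻¹‖ ^ 2 * (‖vt q.1‖ ^ 2 * ‖ut q.2‖ ^ 2 + ‖ut q.1‖ ^ 2 * ‖vt q.2‖ ^ 2) := by
        nlinarith [sq_nonneg (‖vt q.1‖ * ‖ut q.2‖ - ‖ut q.1‖ * ‖vt q.2‖), sq_nonneg ‖ω⁻¹‖,
          mul_nonneg (norm_nonneg (vt q.1)) (norm_nonneg (ut q.2)),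
          mul_nonneg (norm_nonneg (ut q.1)) (norm_nonneg (vt q.2))]

/-- **The kernel integral is the variation-of-parameters expression**: for `ũ, ṽ, F ∈ L²(ℝ)` and
every `x`,
`∫ K(x, y) F(y) dy = −ω⁻¹ ( ṽ(x) ∫_{y ≤ x} ũ F + ũ(x) (∫ ṽ F − ∫_{y ≤ x} ṽ F) )`.
[cite: ReedSimonIV1978, §XIII.14 (Green's function of a Sturm–Liouville operator with `L²` solutions)] -/
theorem integral_greenKernel_mul (hu : MemLp ut 2 volume) (hv : MemLp vt 2 volume) (ω : ℂ)
    {F : ℝ → ℂ} (hF : MemLp F 2 volume) (x : ℝ) :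
    ∫ y, (-ω⁻¹ * (if y ≤ x then vt x * ut y else ut x * vt y)) * F y =
      -ω⁻¹ * (vt x * (∫ y in Iic x, ut y * F y) +
        ut x * ((∫ y, vt y * F y) - ∫ y in Iic x, vt y * F y)) := by
  have hiu : Integrable (fun y ↦ ut y * F y) := hu.integrable_mul hF
  have hiv : Integrable (fun y ↦ vt y * F y) := hv.integrable_mul hF
  -- split the integrand along `Iic x` / `Ioi x`
  have e : ∀ y, (-ω⁻¹ * (if y ≤ x then vt x * ut y else ut x * vt y)) * F y =
      -ω⁻¹ * ((Iic x).indicator (fun y ↦ vt x * (ut y * F y)) y +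
        (Ioi x).indicator (fun y ↦ ut x * (vt y * F y)) y) := by
    intro y
    by_cases hy : y ≤ x
    · rw [if_pos hy, indicator_of_mem (show y ∈ Iic x from hy),
        indicator_of_notMem (show y ∉ Ioi x from not_lt.2 hy)]
      ring
    · rw [if_neg hy, indicator_of_notMem (show y ∉ Iic x from hy),
        indicator_of_mem (show y ∈ Ioi x from lt_of_not_ge hy)]
      ring
  simp_rw [e]
  have hi1 : Integrable ((Iic x).indicator fun y ↦ vt x * (ut y * F y)) :=
    (hiu.const_mul _).indicator measurableSet_Iic
  have hi2 : Integrable ((Ioi x).indicator fun y ↦ ut x * (vt y * F y)) :=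
    (hiv.const_mul _).indicator measurableSet_Ioi
  rw [MeasureTheory.integral_const_mul, integral_add hi1 hi2,
    MeasureTheory.integral_indicator measurableSet_Iic,
    MeasureTheory.integral_indicator measurableSet_Ioi, MeasureTheory.integral_const_mul,
    MeasureTheory.integral_const_mul]
  -- `∫_{Ioi x} = ∫ − ∫_{Iic x}`
  have hsplit : ∫ y in Ioi x, vt y * F y = (∫ y, vt y * F y) - ∫ y in Iic x, vt y * F y := by
    rw [← integral_add_compl (μ := volume) measurableSet_Iic hiv, compl_Iic]
    ring
  rw [hsplit]

/-- **The Green's-kernel operator.**  For `ũ, ṽ ∈ L²(ℝ)` there is a COMPACT operator `R` on `L²(ℝ)`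
acting a.e. by `(R φ)(x) = −ω⁻¹ ( ṽ(x) ∫_{y ≤ x} ũ φ + ũ(x) (∫ ṽ φ − ∫_{y ≤ x} ṽ φ) )`
(the integral operator of the square-integrable kernel `memLp_greenKernel`; Hilbert–Schmidt).
[cite: ReedSimonIV1978, §XIII.14 (Green's function); ReedSimonI1980, Thm. VI.23] -/
theorem exists_greenOp (hu : MemLp ut 2 volume) (hv : MemLp vt 2 volume) (ω : ℂ) :
    ∃ R : L2R →L[ℂ] L2R, IsCompactOperator R ∧ ∀ φ : L2R, (R φ : ℝ → ℂ) =ᵐ[volume] fun x ↦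
      -ω⁻¹ * (vt x * (∫ y in Iic x, ut y * φ y) +
        ut x * ((∫ y, vt y * φ y) - ∫ y in Iic x, vt y * φ y)) := by
  have hK := memLp_greenKernel hu hv ω
  obtain ⟨R, hR⟩ := L2Kernel.exists_op (μ := (volume : Measure ℝ)) hK
  refine ⟨R, isCompactOperator_of_l2Kernel hK hR, fun φ ↦ ?_⟩
  filter_upwards [hR φ] with x hx
  rw [hx]
  exact integral_greenKernel_mul hu hv ω (Lp.memLp φ) x

end Kernel

/-! ## §3 From boundary limits to vanishing integrals on a component -/

section Vanishing

/-- **`∫_{(a, ∞)} Φ = 0` from Green boundary terms**: if `∫_x^y Φ = B(y) − B(x)` for `a < x ≤ y`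
and `B → 0` both at `a⁺` and at `+∞`, then `∫_{(a,∞)} Φ = 0` (`Φ ∈ L¹(a, ∞)`).
[cite: ConnesMoscovici2022, Lemma 1.1 proof (= arXiv:2112.05500 Lemma 2.1, chunk p0004:L44–L48)] -/
theorem setIntegral_Ioi_eq_zero_of_tendsto {a : ℝ} {Φ B : ℝ → ℂ} (hΦ : IntegrableOn Φ (Ioi a))
    (hId : ∀ x ∈ Ioi a, ∀ y ∈ Ioi a, x ≤ y → ∫ t in x..y, Φ t = B y - B x)
    (ha : Tendsto B (𝓝[>] a) (𝓝 0)) (hb : Tendsto B atTop (𝓝 0)) :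
    ∫ t in Ioi a, Φ t = 0 := by
  -- tails: `∫_{(x, ∞)} Φ = −B(x)` for `x > a`
  have htail : ∀ x ∈ Ioi a, ∫ t in Ioi x, Φ t = -B x := by
    intro x hx
    have h1 : Tendsto (fun y ↦ ∫ t in x..y, Φ t) atTop (𝓝 (∫ t in Ioi x, Φ t)) :=
      intervalIntegral_tendsto_integral_Ioi x (hΦ.mono_set (Ioi_subset_Ioi hx.le)) tendsto_id
    have h2 : Tendsto (fun y ↦ ∫ t in x..y, Φ t) atTop (𝓝 (0 - B x)) := by
      refine (hb.sub tendsto_const_nhds).congr' ?_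
      filter_upwards [eventually_ge_atTop x] with y hy
      rw [hId x hx y (lt_of_lt_of_le hx hy) hy]
    rw [tendsto_nhds_unique h1 h2, zero_sub]
  -- split `(a, ∞) = (a, x] ∪ (x, ∞)`
  have hsplit : ∀ x ∈ Ioi a, ∫ t in Ioi a, Φ t = (∫ t in a..x, Φ t) - B x := by
    intro x hx
    rw [← Ioc_union_Ioi_eq_Ioi hx.le, setIntegral_union (Ioc_disjoint_Ioi le_rfl) measurableSet_Ioi
      (hΦ.mono_set Ioc_subset_Ioi_self) (hΦ.mono_set (Ioi_subset_Ioi hx.le)), htail x hx,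
      intervalIntegral.integral_of_le hx.le]
    ring
  -- let `x → a⁺`
  have hprim : Tendsto (fun x ↦ ∫ t in a..x, Φ t) (𝓝[>] a) (𝓝 0) := by
    have hi : IntervalIntegrable Φ volume a (a + 1) := by
      rw [intervalIntegrable_iff_integrableOn_Ioc_of_le (by linarith)]
      exact hΦ.mono_set Ioc_subset_Ioi_self
    have hc := intervalIntegral.continuousOn_primitive_interval' hi left_mem_uIcc
    rw [uIcc_of_le (by linarith)] at hc
    have h0 := ((hc a (left_mem_Icc.2 (by linarith))).mono Ioo_subset_Icc_self).tendsto
    rw [intervalIntegral.integral_same, nhdsWithin_Ioo_eq_nhdsGT (by linarith)] at h0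
    exact h0
  have hlim : Tendsto (fun x ↦ (∫ t in a..x, Φ t) - B x) (𝓝[>] a) (𝓝 (0 - 0)) := hprim.sub ha
  have hconst : Tendsto (fun _ : ℝ ↦ ∫ t in Ioi a, Φ t) (𝓝[>] a) (𝓝 (0 - 0)) :=
    hlim.congr' (by filter_upwards [self_mem_nhdsWithin] with x hx using (hsplit x hx).symm)
  have := tendsto_nhds_unique (tendsto_const_nhds (f := (𝓝[>] a))) hconst
  rw [this, sub_zero]

/-- **`∫_{(−∞, b)} Φ = 0` from Green boundary terms** (mirror of
`setIntegral_Ioi_eq_zero_of_tendsto`). [cite: ConnesMoscovici2022, Lemma 1.1 proof (= arXiv:2112.05500 Lemma 2.1, chunk p0004:L44–L48)] -/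
theorem setIntegral_Iio_eq_zero_of_tendsto {b : ℝ} {Φ B : ℝ → ℂ} (hΦ : IntegrableOn Φ (Iio b))
    (hId : ∀ x ∈ Iio b, ∀ y ∈ Iio b, x ≤ y → ∫ t in x..y, Φ t = B y - B x)
    (ha : Tendsto B atBot (𝓝 0)) (hb : Tendsto B (𝓝[<] b) (𝓝 0)) :
    ∫ t in Iio b, Φ t = 0 := by
  have htail : ∀ y ∈ Iio b, ∫ t in Iic y, Φ t = B y := by
    intro y hy
    have h1 : Tendsto (fun x ↦ ∫ t in x..y, Φ t) atBot (𝓝 (∫ t in Iic y, Φ t)) :=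
      intervalIntegral_tendsto_integral_Iic y (hΦ.mono_set (Iic_subset_Iio.2 hy)) tendsto_id
    have h2 : Tendsto (fun x ↦ ∫ t in x..y, Φ t) atBot (𝓝 (B y - 0)) := by
      refine (tendsto_const_nhds.sub ha).congr' ?_
      filter_upwards [eventually_le_atBot y] with x hx
      rw [hId x (lt_of_le_of_lt hx hy) y hy hx]
    rw [tendsto_nhds_unique h1 h2, sub_zero]
  have hsplit : ∀ y ∈ Iio b, ∫ t in Iio b, Φ t = B y + ∫ t in y..b, Φ t := by
    intro y hy
    rw [← Iic_union_Ioo_eq_Iio hy, setIntegral_union ?_ measurableSet_Ioo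
      (hΦ.mono_set (Iic_subset_Iio.2 hy)) (hΦ.mono_set Ioo_subset_Iio_self), htail y hy,
      intervalIntegral.integral_of_le hy.le, integral_Ioc_eq_integral_Ioo]
    exact Set.disjoint_left.2 fun t ht ht' ↦ (not_lt.2 (mem_Iic.1 ht)) ht'.1
  have hprim : Tendsto (fun y ↦ ∫ t in y..b, Φ t) (𝓝[<] b) (𝓝 0) := by
    have hi : IntervalIntegrable Φ volume (b - 1) b := by
      rw [intervalIntegrable_iff_integrableOn_Ioo_of_le (by linarith)]
      exact hΦ.mono_set Ioo_subset_Iio_self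
    have hc := intervalIntegral.continuousOn_primitive_interval' hi right_mem_uIcc
    rw [uIcc_of_le (by linarith)] at hc
    have h0 := ((hc b (right_mem_Icc.2 (by linarith))).mono Ioo_subset_Icc_self).tendsto
    rw [intervalIntegral.integral_same, nhdsWithin_Ioo_eq_nhdsLT (by linarith)] at h0
    have h1 := h0.neg
    rw [neg_zero] at h1
    refine h1.congr fun y ↦ ?_
    rw [intervalIntegral.integral_symm b y]
  have hlim : Tendsto (fun y ↦ B y + ∫ t in y..b, Φ t) (𝓝[<] b) (𝓝 (0 + 0)) := hb.add hprim
  have hconst : Tendsto (fun _ : ℝ ↦ ∫ t in Iio b, Φ t) (𝓝[<] b) (𝓝 (0 + 0)) :=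
    hlim.congr' (by filter_upwards [self_mem_nhdsWithin] with y hy using (hsplit y hy).symm)
  have := tendsto_nhds_unique (tendsto_const_nhds (f := (𝓝[<] b))) hconst
  rw [this, add_zero]

/-- **`∫_{(a, b)} Φ = 0` from Green boundary terms** (the tree's interval version
`intervalIntegral_eq_zero_of_boundary_tendsto_zero`, restated as a set integral).
[cite: ConnesMoscovici2022, proof of Lemma 1.3 (= arXiv:2112.05500 Lemma 2.3, chunk p0004:L110–L120)] -/
theorem setIntegral_Ioo_eq_zero_of_tendsto {a b : ℝ} (hab : a < b) {Φ B : ℝ → ℂ}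
    (hΦ : IntegrableOn Φ (Ioo a b))
    (hId : ∀ x ∈ Ioo a b, ∀ y ∈ Ioo a b, x ≤ y → ∫ t in x..y, Φ t = B y - B x)
    (ha : Tendsto B (𝓝[>] a) (𝓝 0)) (hb : Tendsto B (𝓝[<] b) (𝓝 0)) :
    ∫ t in Ioo a b, Φ t = 0 := by
  have hi : IntervalIntegrable Φ volume a b := (intervalIntegrable_iff_integrableOn_Ioo_of_le hab.le).2 hΦ
  have h := intervalIntegral_eq_zero_of_boundary_tendsto_zero hab hi hId ha hb
  rwa [intervalIntegral.integral_of_le hab.le, integral_Ioc_eq_integral_Ioo] at h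

end Vanishing

/-! ## §4 The weak equation `(W − z) h = F` on a component from Green's boundary terms -/

section Engine

variable {J : Set ℝ} {lL lR : Filter ℝ} {u u' v v' F h k : ℝ → ℂ} {ω : ℂ}

/-- `L²` functions are interval integrable. [folklore] -/
private theorem intervalIntegrable_of_memLp {g : ℝ → ℂ} (hg : MemLp g 2 volume) (a b : ℝ) :
    IntervalIntegrable g volume a b := by
  rcases le_total a b with hab | hab
  · exact (intervalIntegrable_iff_integrableOn_Icc_of_le hab).2 (integrableOn_Icc_of_memLp hg a b)
  · exact ((intervalIntegrable_iff_integrableOn_Icc_of_le hab).2 (integrableOn_Icc_of_memLp hg b a)).symm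

/-- **The weak equation on a component.**  Let `J` be an open order-connected component of
`ℝ ∖ {±λ}` with a "boundary-term principle" `hzero` (integrals over `J` vanish when the Green
boundary term dies along the two end filters `lL`, `lR`: `setIntegral_Ioi/Iio/Ioo_eq_zero_of_tendsto`),
`(u, v)` a Green pair on `J` with Wronskian `ω ≠ 0`, `F ∈ L²` supported in `J`, and `h ∈ L²` the
variation-of-parameters function (zero off `J`, given by the Green formula on `J`, derivative `k`).
If the boundary term `θ · p k − p θ′ · h` tends to `0` along `lL` and `lR`, then
`∫ (Wθ) h = ∫ θ (z h + F)` — i.e. `(W − z) h = F` weakly, tested against the Schwartz function `θ`.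
[cite: ConnesMoscovici2022, §1 eq. (1.2) and Thm 1.6 (iv) (= arXiv:2112.05500 (2.2), Thm 2.6 (iv), chunks p0004:L16–L22, p0006:L79); §1 (1.5)–(1.6)] -/
theorem weak_identity_component (hJo : IsOpen J) (hJc : OrdConnected J)
    (hJ : J ⊆ {x : ℝ | x ≠ lam ∧ x ≠ -lam})
    (hzero : ∀ Φ B : ℝ → ℂ, IntegrableOn Φ J →
      (∀ x ∈ J, ∀ y ∈ J, x ≤ y → ∫ t in x..y, Φ t = B y - B x) →
      Tendsto B lL (𝓝 0) → Tendsto B lR (𝓝 0) → ∫ t in J, Φ t = 0)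
    (hu : ∀ x ∈ J, HasDerivAt u (u' x) x)
    (huu : ∀ x ∈ J, HasDerivAt (fun y ↦ pCoeff lam y * u' y) ((qCoeff lam x - z) * u x) x)
    (hv : ∀ x ∈ J, HasDerivAt v (v' x) x)
    (hvu : ∀ x ∈ J, HasDerivAt (fun y ↦ pCoeff lam y * v' y) ((qCoeff lam x - z) * v x) x)
    (hW : ∀ x ∈ J, u x * (pCoeff lam x * v' x) - v x * (pCoeff lam x * u' x) = ω) (hω : ω ≠ 0)
    (hu2 : MemLp (J.indicator u) 2 volume) (hv2 : MemLp (J.indicator v) 2 volume)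
    (hF2 : MemLp F 2 volume) (hFJ : ∀ x ∉ J, F x = 0)
    (hh2 : MemLp h 2 volume) (hhJ : ∀ x ∉ J, h x = 0)
    (hh : ∀ x ∈ J, h x = -ω⁻¹ * (v x * (∫ y in Iic x, J.indicator u y * F y) +
      u x * ((∫ y, J.indicator v y * F y) - ∫ y in Iic x, J.indicator v y * F y)))
    (hk : ∀ x ∈ J, k x = -ω⁻¹ * (v' x * (∫ y in Iic x, J.indicator u y * F y) +
      u' x * ((∫ y, J.indicator v y * F y) - ∫ y in Iic x, J.indicator v y * F y)))
    (θ : 𝓢(ℝ, ℂ))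
    (hBL : Tendsto (fun y ↦ θ y * (pCoeff lam y * k y) - pCoeff lam y * deriv θ y * h y) lL (𝓝 0))
    (hBR : Tendsto (fun y ↦ θ y * (pCoeff lam y * k y) - pCoeff lam y * deriv θ y * h y) lR (𝓝 0)) :
    ∫ x, prolateSchwartz lam θ x * h x = ∫ x, θ x * (z * h x + F x) := by
  -- integrability on `ℝ`
  have hi1 : Integrable (fun x ↦ prolateSchwartz lam θ x * h x) :=
    ((prolateSchwartz lam θ).memLp 2 volume).integrable_mul hh2
  have hi2 : Integrable (fun x ↦ θ x * (z * h x + F x)) :=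
    (θ.memLp 2 volume).integrable_mul ((hh2.const_mul z).add hF2)
  rw [← sub_eq_zero, ← integral_sub hi1 hi2]
  set Φ : ℝ → ℂ := fun x ↦ prolateSchwartz lam θ x * h x - θ x * (z * h x + F x) with hΦ
  have hΦ0 : ∀ x, x ∉ J → Φ x = 0 := fun x hx ↦ by
    simp only [hΦ, hhJ x hx, hFJ x hx]; ring
  rw [← setIntegral_eq_integral_of_forall_compl_eq_zero hΦ0]
  -- the boundary-term principle
  refine hzero Φ (fun y ↦ θ y * (pCoeff lam y * k y) - pCoeff lam y * deriv θ y * h y)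
    (hi1.sub hi2).integrableOn ?_ hBL hBR
  intro x hx y hy hxy
  have hI : Icc x y ⊆ J := hJc.out hx hy
  -- integrability of `ũ F`, `ṽ F` on `ℝ`
  have hiuF : Integrable (fun t ↦ J.indicator u t * F t) := hu2.integrable_mul hF2
  have hivF : Integrable (fun t ↦ J.indicator v t * F t) := hv2.integrable_mul hF2
  have hFi : ∀ a ∈ J, ∀ b ∈ J, IntervalIntegrable F volume a b := fun a _ b _ ↦
    intervalIntegrable_of_memLp hF2 a b
  -- the base-point form of the Green formula, with base point `x`
  set α : ℂ := ∫ t in Iic x, J.indicator u t * F t with hα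
  set T : ℂ := ∫ t, J.indicator v t * F t with hT
  set β : ℂ := T - ∫ t in Iic x, J.indicator v t * F t with hβ
  set U : ℝ → ℂ := fun s ↦ ∫ t in x..s, u t * F t with hU
  set V : ℝ → ℂ := fun s ↦ ∫ t in x..s, v t * F t with hV
  set h₁ : ℝ → ℂ := fun s ↦ -(v s * (α + U s) + u s * (β - V s)) / ω with hh₁
  set k₁ : ℝ → ℂ := fun s ↦ -(v' s * (α + U s) + u' s * (β - V s)) / ω with hk₁
  -- agreement of the primitives on `J`
  have hprimU : ∀ s ∈ J, ∫ t in Iic s, J.indicator u t * F t = α + U s := by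
    intro s hs
    have h1 := intervalIntegral.integral_Iic_sub_Iic hiuF.integrableOn hiuF.integrableOn
      (a := x) (b := s) (μ := volume) (f := fun t ↦ J.indicator u t * F t)
    have h2 : ∫ t in x..s, J.indicator u t * F t = U s := by
      simp only [hU]
      refine intervalIntegral.integral_congr fun t ht ↦ ?_
      simp only [indicator_of_mem (hJc.uIcc_subset hx hs ht)]
    rw [hα, ← h2, ← h1]
    ring
  have hprimV : ∀ s ∈ J, (T - ∫ t in Iic s, J.indicator v t * F t) = β - V s := by
    intro s hs
    have h1 := intervalIntegral.integral_Iic_sub_Iic hivF.integrableOn hivF.integrableOn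
      (a := x) (b := s) (μ := volume) (f := fun t ↦ J.indicator v t * F t)
    have h2 : ∫ t in x..s, J.indicator v t * F t = V s := by
      simp only [hV]
      refine intervalIntegral.integral_congr fun t ht ↦ ?_
      simp only [indicator_of_mem (hJc.uIcc_subset hx hs ht)]
    rw [hβ, ← h2, ← h1]
    ring
  have hagree_h : ∀ s ∈ J, h s = h₁ s := fun s hs ↦ by
    rw [hh s hs, hprimU s hs, hprimV s hs, hh₁]
    simp only
    field_simp
  have hagree_k : ∀ s ∈ J, k s = k₁ s := fun s hs ↦ by
    rw [hk s hs, hprimU s hs, hprimV s hs, hk₁]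
    simp only
    field_simp
  -- Green's identity for `h₁` on `[x, y]`
  have hG := greenFormula_intervalIntegral_eq (z := z) (α := α) (β := β) hJ hJo hJc hu huu hv hvu hW hω hFi hx
    (U := U) (V := V) (fun _ ↦ rfl) (fun _ ↦ rfl) (h := h₁) (k := k₁) (fun _ ↦ rfl) (fun _ ↦ rfl)
    (θ := (θ : ℝ → ℂ)) (θ.smooth 2) hx hy hxy
  -- transfer to `h`, `k`
  have hint : ∫ t in x..y, Φ t = ∫ t in x..y,
      ((-deriv (fun s ↦ pCoeff lam s * deriv θ s) t + qCoeff lam t * θ t) * h₁ t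
        - θ t * (z * h₁ t + F t)) := by
    refine intervalIntegral.integral_congr fun t ht ↦ ?_
    have htJ : t ∈ J := by rw [uIcc_of_le hxy] at ht; exact hI ht
    simp only [hΦ, prolateSchwartz_apply', hagree_h t htJ]
  rw [hint, hG, hagree_h y hy, hagree_h x hx, hagree_k y hy, hagree_k x hx]

end Engine

/-! ## §5 The three components -/

section Components

/-- The indicator of a continuous square-integrable function on a measurable set is in `L²(ℝ)`.
[folklore] -/
private theorem memLp_indicator_of_sq {J : Set ℝ} (hJm : MeasurableSet J) {g : ℝ → ℂ}
    (hgc : ContinuousOn g J) (hg2 : IntegrableOn (fun x ↦ ‖g x‖ ^ 2) J) :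
    MemLp (J.indicator g) 2 volume := by
  rw [memLp_indicator_iff_restrict hJm]
  exact (memLp_two_iff_integrable_sq_norm (hgc.aestronglyMeasurable hJm)).2 hg2

/-- `x ↦ ∫_{y ≤ x} g` is continuous for `g ∈ L¹(ℝ)`. [folklore] -/
private theorem continuous_setIntegral_Iic {g : ℝ → ℂ} (hg : Integrable g) :
    Continuous fun x ↦ ∫ y in Iic x, g y := by
  have h : (fun x ↦ ∫ y in Iic x, g y) = fun x ↦ (∫ y in Iic (0 : ℝ), g y) + ∫ y in (0 : ℝ)..x, g y := by
    funext x
    rw [← intervalIntegral.integral_Iic_sub_Iic hg.integrableOn hg.integrableOn]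
    ring
  rw [h]
  exact continuous_const.add (intervalIntegral.continuous_primitive (fun a b ↦ hg.intervalIntegrable) 0)

/-- `‖∫_{y ≤ x} g‖ ≤ ∫ ‖g‖`. [folklore] -/
private theorem norm_setIntegral_Iic_le {g : ℝ → ℂ} (hg : Integrable g) (x : ℝ) :
    ‖∫ y in Iic x, g y‖ ≤ ∫ y, ‖g y‖ :=
  (MeasureTheory.norm_integral_le_integral_norm _).trans
    (setIntegral_le_integral hg.norm (Eventually.of_forall fun _ ↦ norm_nonneg _))

/-- A bound `‖g x‖ ≤ C / x` for `x > x₀ ≥ 1` gives `‖g x‖ ≤ |C|` there. [folklore] -/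
private theorem norm_le_abs_of_div {a : ℂ} {C x₀ t : ℝ} (hx₀ : 1 ≤ x₀) (ht : x₀ < t)
    (h : ‖a‖ ≤ C / t) : ‖a‖ ≤ |C| := by
  have ht1 : 1 ≤ t := by linarith
  refine h.trans ((div_le_iff₀ (by linarith)).2 ?_)
  nlinarith [le_abs_self C, abs_nonneg C]

/-- **The Green operator of the component `(λ, ∞)`.**  There is a compact operator `R` on `L²(ℝ)`
with `∫ (Wθ) (R f) = ∫ θ (z R f + 1_{(λ,∞)} f)` for every `f ∈ L²(ℝ)` and every Schwartz `θ`: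
`(W − z) R f = 1_{(λ,∞)} f` weakly, with all Green boundary terms vanishing (at `λ⁺` because the
solution governing that end is regular there, at `+∞` by the `O(1/x)` decay of solutions).
[cite: ConnesMoscovici2022, Thm 1.6 (iv) (= arXiv:2112.05500 Thm 2.6 (iv), chunk p0006:L79); Lemma 1.1 proof (chunk p0004:L44–L48)] -/
theorem exists_greenOp_Ioi (hlam : 0 < lam) (z : ℂ) :
    ∃ R : L2R →L[ℂ] L2R, IsCompactOperator R ∧ ∀ (f : L2R) (θ : 𝓢(ℝ, ℂ)),
      ∫ x, prolateSchwartz lam θ x * (R f : ℝ → ℂ) x =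
        ∫ x, θ x * (z * (R f : ℝ → ℂ) x + (Ioi lam).indicator (f : ℝ → ℂ) x) := by
  set J : Set ℝ := Ioi lam with hJdef
  obtain ⟨u, u', v, v', ω, c, hω, hc, hsu, hsv, hu0, hvc, hW⟩ := exists_greenPair_Ioi hlam z
  have hJ : J ⊆ {x : ℝ | x ≠ lam ∧ x ≠ -lam} := Ioi_subset_setOf_ne_ne hlam
  have hJm : MeasurableSet J := measurableSet_Ioi
  have huc : ContinuousOn u J := fun x hx ↦ (hsu x hx).1.continuousAt.continuousWithinAt
  have hvc' : ContinuousOn v J := fun x hx ↦ (hsv x hx).1.continuousAt.continuousWithinAt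
  have hu2 : MemLp (J.indicator u) 2 volume := memLp_indicator_of_sq hJm huc
    (prolate_sq_integrableOn_Ioi_lam hlam z (fun x hx ↦ (hsu x hx).1) (fun x hx ↦ (hsu x hx).2))
  have hv2 : MemLp (J.indicator v) 2 volume := memLp_indicator_of_sq hJm hvc'
    (prolate_sq_integrableOn_Ioi_lam hlam z (fun x hx ↦ (hsv x hx).1) (fun x hx ↦ (hsv x hx).2))
  obtain ⟨R, hRc, hR⟩ := exists_greenOp hu2 hv2 ω
  refine ⟨R, hRc, fun f θ ↦ ?_⟩
  -- the right-hand side restricted to `J`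
  set F : ℝ → ℂ := J.indicator (f : ℝ → ℂ) with hFdef
  have hF2 : MemLp F 2 volume := (Lp.memLp f).indicator hJm
  have hFJ : ∀ x ∉ J, F x = 0 := fun x hx ↦ indicator_of_notMem hx _
  have huF : ∀ y, J.indicator u y * (f : ℝ → ℂ) y = J.indicator u y * F y := by
    intro y; by_cases hy : y ∈ J
    · simp [hFdef, indicator_of_mem hy]
    · simp [indicator_of_notMem hy]
  have hvF : ∀ y, J.indicator v y * (f : ℝ → ℂ) y = J.indicator v y * F y := by
    intro y; by_cases hy : y ∈ J
    · simp [hFdef, indicator_of_mem hy]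
    · simp [indicator_of_notMem hy]
  have hiuF : Integrable (fun t ↦ J.indicator u t * F t) := hu2.integrable_mul hF2
  have hivF : Integrable (fun t ↦ J.indicator v t * F t) := hv2.integrable_mul hF2
  -- the primitives
  set A : ℝ → ℂ := fun x ↦ ∫ y in Iic x, J.indicator u y * F y with hAdef
  set T : ℂ := ∫ y, J.indicator v y * F y with hTdef
  set A' : ℝ → ℂ := fun x ↦ ∫ y in Iic x, J.indicator v y * F y with hA'def
  set h : ℝ → ℂ := fun x ↦ -ω⁻¹ * (J.indicator v x * A x + J.indicator u x * (T - A' x)) with hhdef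
  set k : ℝ → ℂ := fun x ↦ -ω⁻¹ * (J.indicator v' x * A x + J.indicator u' x * (T - A' x)) with hkdef
  -- `R f = h` a.e.
  have hae : (R f : ℝ → ℂ) =ᵐ[volume] h := by
    filter_upwards [hR f] with x hx
    rw [hx, hhdef]
    simp only [hAdef, hTdef, hA'def]
    simp_rw [huF, hvF]
  have hh2 : MemLp h 2 volume := (Lp.memLp (R f)).ae_eq hae
  have hhJ : ∀ x ∉ J, h x = 0 := fun x hx ↦ by
    simp [hhdef, indicator_of_notMem hx]
  have hh : ∀ x ∈ J, h x = -ω⁻¹ * (v x * (∫ y in Iic x, J.indicator u y * F y) +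
      u x * ((∫ y, J.indicator v y * F y) - ∫ y in Iic x, J.indicator v y * F y)) := fun x hx ↦ by
    simp [hhdef, hAdef, hTdef, hA'def, indicator_of_mem hx]
  have hk : ∀ x ∈ J, k x = -ω⁻¹ * (v' x * (∫ y in Iic x, J.indicator u y * F y) +
      u' x * ((∫ y, J.indicator v y * F y) - ∫ y in Iic x, J.indicator v y * F y)) := fun x hx ↦ by
    simp [hkdef, hAdef, hTdef, hA'def, indicator_of_mem hx]
  -- continuity and bounds of the primitives
  have hAc : Continuous A := continuous_setIntegral_Iic hiuF
  have hA'c : Continuous A' := continuous_setIntegral_Iic hivF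
  have hA0 : A lam = 0 := by
    simp only [hAdef]
    refine setIntegral_eq_zero_of_forall_eq_zero fun y hy ↦ ?_
    rw [indicator_of_notMem (show y ∉ J from fun h ↦ not_lt.2 (mem_Iic.1 hy) h), zero_mul]
  have hAt : Tendsto A (𝓝[>] lam) (𝓝 0) := by
    have := (hAc.tendsto lam).mono_left (nhdsWithin_le_nhds (s := Ioi lam))
    rwa [hA0] at this
  have hA't : Tendsto (fun x ↦ T - A' x) (𝓝[>] lam) (𝓝 (T - A' lam)) :=
    ((continuous_const.sub hA'c).tendsto lam).mono_left nhdsWithin_le_nhds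
  -- boundary term at `λ⁺`
  have hpk : Tendsto (fun x ↦ pCoeff lam x * k x) (𝓝[>] lam) (𝓝 0) := by
    have h1 := ((hvc.mul hAt).add (hu0.mul hA't)).const_mul (-ω⁻¹)
    rw [mul_zero, zero_mul, zero_add, mul_zero] at h1
    refine h1.congr' ?_
    filter_upwards [self_mem_nhdsWithin] with x hx
    simp only [hkdef, indicator_of_mem (show x ∈ J from hx)]
    ring
  have hxh : Tendsto (fun x ↦ ((x - lam : ℝ) : ℂ) * h x) (𝓝[>] lam) (𝓝 0) := by
    obtain ⟨-, hv0', -⟩ := prolate_singularEndpoint_right hlam z (fun x hx ↦ (hsv x hx).1)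
      (fun x hx ↦ (hsv x hx).2)
    obtain ⟨-, hu0', -⟩ := prolate_singularEndpoint_right hlam z (fun x hx ↦ (hsu x hx).1)
      (fun x hx ↦ (hsu x hx).2)
    have h1 := ((hv0'.mul hAt).add (hu0'.mul hA't)).const_mul (-ω⁻¹)
    rw [mul_zero, zero_mul, zero_add, mul_zero] at h1
    refine h1.congr' ?_
    filter_upwards [self_mem_nhdsWithin] with x hx
    simp only [hhdef, indicator_of_mem (show x ∈ J from hx)]
    ring
  have hBL : Tendsto (fun y ↦ θ y * (pCoeff lam y * k y) - pCoeff lam y * deriv θ y * h y)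
      (𝓝[>] lam) (𝓝 0) := by
    have h1 := tendsto_green_boundary_finite (lam := lam) θ (a := lam) rfl nhdsWithin_le_nhds hpk hxh
    rw [mul_zero] at h1
    exact h1.congr fun y ↦ by ring
  -- boundary term at `+∞`
  have hBR : Tendsto (fun y ↦ θ y * (pCoeff lam y * k y) - pCoeff lam y * deriv θ y * h y)
      atTop (𝓝 0) := by
    obtain ⟨Cu, hCu⟩ := prolate_decay_atTop hlam z (fun x hx ↦ (hsu x hx).1) (fun x hx ↦ (hsu x hx).2)
    obtain ⟨Cv, hCv⟩ := prolate_decay_atTop hlam z (fun x hx ↦ (hsv x hx).1) (fun x hx ↦ (hsv x hx).2)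
    set M₁ : ℝ := ∫ y, ‖J.indicator u y * F y‖
    set M₂ : ℝ := ∫ y, ‖J.indicator v y * F y‖
    set R₀ : ℝ := max (2 * lam) 1 + 1 with hR₀
    set C₀ : ℝ := ‖ω⁻¹‖ * (|Cv| * M₁ + |Cu| * (‖T‖ + M₂)) with hC₀
    have hM₁ : 0 ≤ M₁ := integral_nonneg fun _ ↦ norm_nonneg _
    have hM₂ : 0 ≤ M₂ := integral_nonneg fun _ ↦ norm_nonneg _
    have hC₀0 : 0 ≤ C₀ := by positivity
    have hAb : ∀ x, ‖A x‖ ≤ M₁ := fun x ↦ norm_setIntegral_Iic_le hiuF x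
    have hA'b : ∀ x, ‖T - A' x‖ ≤ ‖T‖ + M₂ := fun x ↦
      (norm_sub_le _ _).trans (by gcongr; exact norm_setIntegral_Iic_le hivF x)
    have hbound : ∀ g g' : ℝ → ℂ, (∀ x : ℝ, max (2 * lam) 1 < x → ‖g x‖ ≤ Cv / x) →
        (∀ x : ℝ, max (2 * lam) 1 < x → ‖g' x‖ ≤ Cu / x) → ∀ x, R₀ ≤ |x| →
        ‖-ω⁻¹ * (J.indicator g x * A x + J.indicator g' x * (T - A' x))‖ ≤ C₀ := by
      intro g g' hg hg' x hx
      by_cases hxJ : x ∈ J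
      · have hxpos : 0 < x := lt_trans hlam hxJ
        have hx' : max (2 * lam) 1 < x := by
          rw [abs_of_pos hxpos] at hx; rw [hR₀] at hx; linarith
        have h1 : ‖g x‖ ≤ |Cv| := norm_le_abs_of_div (le_max_right _ _) hx' (hg x hx')
        have h2 : ‖g' x‖ ≤ |Cu| := norm_le_abs_of_div (le_max_right _ _) hx' (hg' x hx')
        rw [indicator_of_mem hxJ, indicator_of_mem hxJ, norm_mul, norm_neg, hC₀]
        gcongr
        calc ‖g x * A x + g' x * (T - A' x)‖ ≤ ‖g x‖ * ‖A x‖ + ‖g' x‖ * ‖T - A' x‖ := by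
              refine (norm_add_le _ _).trans ?_; rw [norm_mul, norm_mul]
          _ ≤ |Cv| * M₁ + |Cu| * (‖T‖ + M₂) :=
              add_le_add (mul_le_mul h1 (hAb x) (norm_nonneg _) (abs_nonneg _))
                (mul_le_mul h2 (hA'b x) (norm_nonneg _) (abs_nonneg _))
      · rw [indicator_of_notMem hxJ, indicator_of_notMem hxJ]
        simpa using hC₀0
    have hb : ∀ x, R₀ ≤ |x| → ‖h x‖ ≤ C₀ ∧ ‖k x‖ ≤ C₀ := fun x hx ↦
      ⟨hbound v u (fun y hy ↦ (hCv y hy).1) (fun y hy ↦ (hCu y hy).1) x hx,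
        hbound v' u' (fun y hy ↦ (hCv y hy).2) (fun y hy ↦ (hCu y hy).2) x hx⟩
    have h1 := tendsto_green_boundary_cocompact (lam := lam) θ hb atTop_le_cocompact
      (by filter_upwards [eventually_ge_atTop R₀] with x hx using hx.trans (le_abs_self x))
    exact h1.congr fun y ↦ by ring
  -- the weak equation for `h`, then for `R f`
  have hmain := weak_identity_component (lL := 𝓝[>] lam) (lR := atTop) isOpen_Ioi ordConnected_Ioi hJ
    (fun Φ B hΦ hId hL hR' ↦ setIntegral_Ioi_eq_zero_of_tendsto hΦ hId hL hR')
    (fun x hx ↦ (hsu x hx).1) (fun x hx ↦ (hsu x hx).2) (fun x hx ↦ (hsv x hx).1)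
    (fun x hx ↦ (hsv x hx).2) hW hω hu2 hv2 hF2 hFJ hh2 hhJ hh hk θ hBL hBR
  have e1 : ∫ x, prolateSchwartz lam θ x * (R f : ℝ → ℂ) x = ∫ x, prolateSchwartz lam θ x * h x :=
    integral_congr_ae (by filter_upwards [hae] with x hx; rw [hx])
  have e2 : ∫ x, θ x * (z * (R f : ℝ → ℂ) x + F x) = ∫ x, θ x * (z * h x + F x) :=
    integral_congr_ae (by filter_upwards [hae] with x hx; rw [hx])
  rw [e1, e2, hmain]

/-- **The Green operator of the component `(−∞, −λ)`** (mirror of `exists_greenOp_Ioi`: the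
solution governing `(−λ)⁻` is regular there, the other end is `−∞`).
[cite: ConnesMoscovici2022, Thm 1.6 (iv) (= arXiv:2112.05500 Thm 2.6 (iv), chunk p0006:L79); Lemma 1.1 proof (chunk p0004:L44–L48)] -/
theorem exists_greenOp_Iio (hlam : 0 < lam) (z : ℂ) :
    ∃ R : L2R →L[ℂ] L2R, IsCompactOperator R ∧ ∀ (f : L2R) (θ : 𝓢(ℝ, ℂ)),
      ∫ x, prolateSchwartz lam θ x * (R f : ℝ → ℂ) x =
        ∫ x, θ x * (z * (R f : ℝ → ℂ) x + (Iio (-lam)).indicator (f : ℝ → ℂ) x) := by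
  set J : Set ℝ := Iio (-lam) with hJdef
  obtain ⟨u, u', v, v', ω, c, hω, hc, hsu, hsv, hv0, huc0, hW⟩ := exists_greenPair_Iio hlam z
  have hJ : J ⊆ {x : ℝ | x ≠ lam ∧ x ≠ -lam} := Iio_subset_setOf_ne_ne hlam
  have hJm : MeasurableSet J := measurableSet_Iio
  have huc : ContinuousOn u J := fun x hx ↦ (hsu x hx).1.continuousAt.continuousWithinAt
  have hvc' : ContinuousOn v J := fun x hx ↦ (hsv x hx).1.continuousAt.continuousWithinAt
  have hu2 : MemLp (J.indicator u) 2 volume := memLp_indicator_of_sq hJm huc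
    (prolate_sq_integrableOn_Iio_neg_lam hlam z (fun x hx ↦ (hsu x hx).1) (fun x hx ↦ (hsu x hx).2))
  have hv2 : MemLp (J.indicator v) 2 volume := memLp_indicator_of_sq hJm hvc'
    (prolate_sq_integrableOn_Iio_neg_lam hlam z (fun x hx ↦ (hsv x hx).1) (fun x hx ↦ (hsv x hx).2))
  obtain ⟨R, hRc, hR⟩ := exists_greenOp hu2 hv2 ω
  refine ⟨R, hRc, fun f θ ↦ ?_⟩
  set F : ℝ → ℂ := J.indicator (f : ℝ → ℂ) with hFdef
  have hF2 : MemLp F 2 volume := (Lp.memLp f).indicator hJm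
  have hFJ : ∀ x ∉ J, F x = 0 := fun x hx ↦ indicator_of_notMem hx _
  have huF : ∀ y, J.indicator u y * (f : ℝ → ℂ) y = J.indicator u y * F y := by
    intro y; by_cases hy : y ∈ J
    · simp [hFdef, indicator_of_mem hy]
    · simp [indicator_of_notMem hy]
  have hvF : ∀ y, J.indicator v y * (f : ℝ → ℂ) y = J.indicator v y * F y := by
    intro y; by_cases hy : y ∈ J
    · simp [hFdef, indicator_of_mem hy]
    · simp [indicator_of_notMem hy]
  have hiuF : Integrable (fun t ↦ J.indicator u t * F t) := hu2.integrable_mul hF2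
  have hivF : Integrable (fun t ↦ J.indicator v t * F t) := hv2.integrable_mul hF2
  set A : ℝ → ℂ := fun x ↦ ∫ y in Iic x, J.indicator u y * F y with hAdef
  set T : ℂ := ∫ y, J.indicator v y * F y with hTdef
  set A' : ℝ → ℂ := fun x ↦ ∫ y in Iic x, J.indicator v y * F y with hA'def
  set h : ℝ → ℂ := fun x ↦ -ω⁻¹ * (J.indicator v x * A x + J.indicator u x * (T - A' x)) with hhdef
  set k : ℝ → ℂ := fun x ↦ -ω⁻¹ * (J.indicator v' x * A x + J.indicator u' x * (T - A' x)) with hkdef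
  have hae : (R f : ℝ → ℂ) =ᵐ[volume] h := by
    filter_upwards [hR f] with x hx
    rw [hx, hhdef]
    simp only [hAdef, hTdef, hA'def]
    simp_rw [huF, hvF]
  have hh2 : MemLp h 2 volume := (Lp.memLp (R f)).ae_eq hae
  have hhJ : ∀ x ∉ J, h x = 0 := fun x hx ↦ by
    simp [hhdef, indicator_of_notMem hx]
  have hh : ∀ x ∈ J, h x = -ω⁻¹ * (v x * (∫ y in Iic x, J.indicator u y * F y) +
      u x * ((∫ y, J.indicator v y * F y) - ∫ y in Iic x, J.indicator v y * F y)) := fun x hx ↦ by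
    simp [hhdef, hAdef, hTdef, hA'def, indicator_of_mem hx]
  have hk : ∀ x ∈ J, k x = -ω⁻¹ * (v' x * (∫ y in Iic x, J.indicator u y * F y) +
      u' x * ((∫ y, J.indicator v y * F y) - ∫ y in Iic x, J.indicator v y * F y)) := fun x hx ↦ by
    simp [hkdef, hAdef, hTdef, hA'def, indicator_of_mem hx]
  have hAc : Continuous A := continuous_setIntegral_Iic hiuF
  have hA'c : Continuous A' := continuous_setIntegral_Iic hivF
  -- at `(−λ)⁻`: `T − A′ → 0`, `A → A(−λ)`
  have hA'0 : T - A' (-lam) = 0 := by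
    simp only [hTdef, hA'def]
    rw [setIntegral_eq_integral_of_forall_compl_eq_zero fun y hy ↦ ?_, sub_self]
    rw [indicator_of_notMem (show y ∉ J from fun h ↦ hy (mem_Iic.2 (le_of_lt h))), zero_mul]
  have hAt : Tendsto A (𝓝[<] (-lam)) (𝓝 (A (-lam))) :=
    (hAc.tendsto (-lam)).mono_left nhdsWithin_le_nhds
  have hA't : Tendsto (fun x ↦ T - A' x) (𝓝[<] (-lam)) (𝓝 0) := by
    have h1 : Tendsto (fun x ↦ T - A' x) (𝓝[<] (-lam)) (𝓝 (T - A' (-lam))) :=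
      ((continuous_const.sub hA'c).tendsto (-lam)).mono_left nhdsWithin_le_nhds
    rwa [hA'0] at h1
  have hpk : Tendsto (fun x ↦ pCoeff lam x * k x) (𝓝[<] (-lam)) (𝓝 0) := by
    have h1 := ((hv0.mul hAt).add (huc0.mul hA't)).const_mul (-ω⁻¹)
    rw [zero_mul, mul_zero, zero_add, mul_zero] at h1
    refine h1.congr' ?_
    filter_upwards [self_mem_nhdsWithin] with x hx
    simp only [hkdef, indicator_of_mem (show x ∈ J from hx)]
    ring
  have hxh : Tendsto (fun x ↦ ((x - -lam : ℝ) : ℂ) * h x) (𝓝[<] (-lam)) (𝓝 0) := by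
    obtain ⟨-, hv0', -⟩ := prolate_singularEndpoint_left hlam z (fun x hx ↦ (hsv x hx).1)
      (fun x hx ↦ (hsv x hx).2)
    obtain ⟨-, hu0', -⟩ := prolate_singularEndpoint_left hlam z (fun x hx ↦ (hsu x hx).1)
      (fun x hx ↦ (hsu x hx).2)
    have h1 := (((hv0'.neg).mul hAt).add ((hu0'.neg).mul hA't)).const_mul (-ω⁻¹)
    rw [neg_zero, zero_mul, mul_zero, zero_add, mul_zero] at h1
    refine h1.congr' ?_
    filter_upwards [self_mem_nhdsWithin] with x hx
    simp only [hhdef, indicator_of_mem (show x ∈ J from hx)]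
    push_cast
    ring
  have hBR : Tendsto (fun y ↦ θ y * (pCoeff lam y * k y) - pCoeff lam y * deriv θ y * h y)
      (𝓝[<] (-lam)) (𝓝 0) := by
    have h1 := tendsto_green_boundary_finite (lam := lam) θ (a := -lam) (by ring) nhdsWithin_le_nhds hpk hxh
    rw [mul_zero] at h1
    exact h1.congr fun y ↦ by ring
  -- at `−∞`
  have hBL : Tendsto (fun y ↦ θ y * (pCoeff lam y * k y) - pCoeff lam y * deriv θ y * h y)
      atBot (𝓝 0) := by
    obtain ⟨Cu, hCu⟩ := prolate_decay_atBot hlam z (fun x hx ↦ (hsu x hx).1) (fun x hx ↦ (hsu x hx).2)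
    obtain ⟨Cv, hCv⟩ := prolate_decay_atBot hlam z (fun x hx ↦ (hsv x hx).1) (fun x hx ↦ (hsv x hx).2)
    set M₁ : ℝ := ∫ y, ‖J.indicator u y * F y‖
    set M₂ : ℝ := ∫ y, ‖J.indicator v y * F y‖
    set R₀ : ℝ := max (2 * lam) 1 + 1 with hR₀
    set C₀ : ℝ := ‖ω⁻¹‖ * (|Cv| * M₁ + |Cu| * (‖T‖ + M₂)) with hC₀
    have hM₁ : 0 ≤ M₁ := integral_nonneg fun _ ↦ norm_nonneg _
    have hM₂ : 0 ≤ M₂ := integral_nonneg fun _ ↦ norm_nonneg _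
    have hC₀0 : 0 ≤ C₀ := by positivity
    have hAb : ∀ x, ‖A x‖ ≤ M₁ := fun x ↦ norm_setIntegral_Iic_le hiuF x
    have hA'b : ∀ x, ‖T - A' x‖ ≤ ‖T‖ + M₂ := fun x ↦
      (norm_sub_le _ _).trans (by gcongr; exact norm_setIntegral_Iic_le hivF x)
    have hbound : ∀ g g' : ℝ → ℂ, (∀ x : ℝ, x < -max (2 * lam) 1 → ‖g x‖ ≤ Cv / (-x)) →
        (∀ x : ℝ, x < -max (2 * lam) 1 → ‖g' x‖ ≤ Cu / (-x)) → ∀ x, R₀ ≤ |x| →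
        ‖-ω⁻¹ * (J.indicator g x * A x + J.indicator g' x * (T - A' x))‖ ≤ C₀ := by
      intro g g' hg hg' x hx
      by_cases hxJ : x ∈ J
      · have hxneg : x < 0 := lt_trans hxJ (by linarith)
        have hx' : max (2 * lam) 1 < -x := by
          rw [abs_of_neg hxneg] at hx; rw [hR₀] at hx; linarith
        have hx'' : x < -max (2 * lam) 1 := by linarith
        have h1 : ‖g x‖ ≤ |Cv| := norm_le_abs_of_div (le_max_right _ _) hx' (hg x hx'')
        have h2 : ‖g' x‖ ≤ |Cu| := norm_le_abs_of_div (le_max_right _ _) hx' (hg' x hx'')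
        rw [indicator_of_mem hxJ, indicator_of_mem hxJ, norm_mul, norm_neg, hC₀]
        gcongr
        calc ‖g x * A x + g' x * (T - A' x)‖ ≤ ‖g x‖ * ‖A x‖ + ‖g' x‖ * ‖T - A' x‖ := by
              refine (norm_add_le _ _).trans ?_; rw [norm_mul, norm_mul]
          _ ≤ |Cv| * M₁ + |Cu| * (‖T‖ + M₂) :=
              add_le_add (mul_le_mul h1 (hAb x) (norm_nonneg _) (abs_nonneg _))
                (mul_le_mul h2 (hA'b x) (norm_nonneg _) (abs_nonneg _))
      · rw [indicator_of_notMem hxJ, indicator_of_notMem hxJ]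
        simpa using hC₀0
    have hb : ∀ x, R₀ ≤ |x| → ‖h x‖ ≤ C₀ ∧ ‖k x‖ ≤ C₀ := fun x hx ↦
      ⟨hbound v u (fun y hy ↦ (hCv y hy).1) (fun y hy ↦ (hCu y hy).1) x hx,
        hbound v' u' (fun y hy ↦ (hCv y hy).2) (fun y hy ↦ (hCu y hy).2) x hx⟩
    have h1 := tendsto_green_boundary_cocompact (lam := lam) θ hb atBot_le_cocompact
      (by filter_upwards [eventually_le_atBot (-R₀)] with x hx
          exact le_trans (by linarith) (neg_le_abs x))
    exact h1.congr fun y ↦ by ring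
  have hmain := weak_identity_component (lL := atBot) (lR := 𝓝[<] (-lam)) isOpen_Iio ordConnected_Iio hJ
    (fun Φ B hΦ hId hL hR' ↦ setIntegral_Iio_eq_zero_of_tendsto hΦ hId hL hR')
    (fun x hx ↦ (hsu x hx).1) (fun x hx ↦ (hsu x hx).2) (fun x hx ↦ (hsv x hx).1)
    (fun x hx ↦ (hsv x hx).2) hW hω hu2 hv2 hF2 hFJ hh2 hhJ hh hk θ hBL hBR
  have e1 : ∫ x, prolateSchwartz lam θ x * (R f : ℝ → ℂ) x = ∫ x, prolateSchwartz lam θ x * h x :=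
    integral_congr_ae (by filter_upwards [hae] with x hx; rw [hx])
  have e2 : ∫ x, θ x * (z * (R f : ℝ → ℂ) x + F x) = ∫ x, θ x * (z * h x + F x) :=
    integral_congr_ae (by filter_upwards [hae] with x hx; rw [hx])
  rw [e1, e2, hmain]

/-- **The Green operator of the middle component `(−λ, λ)`** (`Im z ≠ 0`; both ends finite and
singular, the solutions governing them regular there).
[cite: ConnesMoscovici2022, Thm 1.6 (iv) (= arXiv:2112.05500 Thm 2.6 (iv), chunk p0006:L79); Lemma 1.1 proof (chunk p0004:L44–L48)] -/
theorem exists_greenOp_Ioo (hlam : 0 < lam) (hz : z.im ≠ 0) :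
    ∃ R : L2R →L[ℂ] L2R, IsCompactOperator R ∧ ∀ (f : L2R) (θ : 𝓢(ℝ, ℂ)),
      ∫ x, prolateSchwartz lam θ x * (R f : ℝ → ℂ) x =
        ∫ x, θ x * (z * (R f : ℝ → ℂ) x + (Ioo (-lam) lam).indicator (f : ℝ → ℂ) x) := by
  set J : Set ℝ := Ioo (-lam) lam with hJdef
  have hll : -lam < lam := by linarith
  obtain ⟨u, u', v, v', ω, hω, hsu, hsv, hu0, hv0, hW⟩ := exists_greenPair_Ioo hlam hz
  have hJ : J ⊆ {x : ℝ | x ≠ lam ∧ x ≠ -lam} := Ioo_subset_setOf_ne_ne lam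
  have hJm : MeasurableSet J := measurableSet_Ioo
  have huc : ContinuousOn u J := fun x hx ↦ (hsu x hx).1.continuousAt.continuousWithinAt
  have hvc' : ContinuousOn v J := fun x hx ↦ (hsv x hx).1.continuousAt.continuousWithinAt
  have hu2 : MemLp (J.indicator u) 2 volume := memLp_indicator_of_sq hJm huc
    (prolate_sq_integrableOn_mid hlam z (fun x hx ↦ (hsu x hx).1) (fun x hx ↦ (hsu x hx).2))
  have hv2 : MemLp (J.indicator v) 2 volume := memLp_indicator_of_sq hJm hvc'
    (prolate_sq_integrableOn_mid hlam z (fun x hx ↦ (hsv x hx).1) (fun x hx ↦ (hsv x hx).2))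
  obtain ⟨R, hRc, hR⟩ := exists_greenOp hu2 hv2 ω
  refine ⟨R, hRc, fun f θ ↦ ?_⟩
  set F : ℝ → ℂ := J.indicator (f : ℝ → ℂ) with hFdef
  have hF2 : MemLp F 2 volume := (Lp.memLp f).indicator hJm
  have hFJ : ∀ x ∉ J, F x = 0 := fun x hx ↦ indicator_of_notMem hx _
  have huF : ∀ y, J.indicator u y * (f : ℝ → ℂ) y = J.indicator u y * F y := by
    intro y; by_cases hy : y ∈ J
    · simp [hFdef, indicator_of_mem hy]
    · simp [indicator_of_notMem hy]
  have hvF : ∀ y, J.indicator v y * (f : ℝ → ℂ) y = J.indicator v y * F y := by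
    intro y; by_cases hy : y ∈ J
    · simp [hFdef, indicator_of_mem hy]
    · simp [indicator_of_notMem hy]
  have hiuF : Integrable (fun t ↦ J.indicator u t * F t) := hu2.integrable_mul hF2
  have hivF : Integrable (fun t ↦ J.indicator v t * F t) := hv2.integrable_mul hF2
  set A : ℝ → ℂ := fun x ↦ ∫ y in Iic x, J.indicator u y * F y with hAdef
  set T : ℂ := ∫ y, J.indicator v y * F y with hTdef
  set A' : ℝ → ℂ := fun x ↦ ∫ y in Iic x, J.indicator v y * F y with hA'def
  set h : ℝ → ℂ := fun x ↦ -ω⁻¹ * (J.indicator v x * A x + J.indicator u x * (T - A' x)) with hhdef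
  set k : ℝ → ℂ := fun x ↦ -ω⁻¹ * (J.indicator v' x * A x + J.indicator u' x * (T - A' x)) with hkdef
  have hae : (R f : ℝ → ℂ) =ᵐ[volume] h := by
    filter_upwards [hR f] with x hx
    rw [hx, hhdef]
    simp only [hAdef, hTdef, hA'def]
    simp_rw [huF, hvF]
  have hh2 : MemLp h 2 volume := (Lp.memLp (R f)).ae_eq hae
  have hhJ : ∀ x ∉ J, h x = 0 := fun x hx ↦ by
    simp [hhdef, indicator_of_notMem hx]
  have hh : ∀ x ∈ J, h x = -ω⁻¹ * (v x * (∫ y in Iic x, J.indicator u y * F y) +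
      u x * ((∫ y, J.indicator v y * F y) - ∫ y in Iic x, J.indicator v y * F y)) := fun x hx ↦ by
    simp [hhdef, hAdef, hTdef, hA'def, indicator_of_mem hx]
  have hk : ∀ x ∈ J, k x = -ω⁻¹ * (v' x * (∫ y in Iic x, J.indicator u y * F y) +
      u' x * ((∫ y, J.indicator v y * F y) - ∫ y in Iic x, J.indicator v y * F y)) := fun x hx ↦ by
    simp [hkdef, hAdef, hTdef, hA'def, indicator_of_mem hx]
  have hAc : Continuous A := continuous_setIntegral_Iic hiuF
  have hA'c : Continuous A' := continuous_setIntegral_Iic hivF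
  -- limits of the primitives at the two ends
  have hA0 : A (-lam) = 0 := by
    simp only [hAdef]
    refine setIntegral_eq_zero_of_forall_eq_zero fun y hy ↦ ?_
    rw [indicator_of_notMem (show y ∉ J from fun h ↦ not_lt.2 (mem_Iic.1 hy) h.1), zero_mul]
  have hA'0 : T - A' lam = 0 := by
    simp only [hTdef, hA'def]
    rw [setIntegral_eq_integral_of_forall_compl_eq_zero fun y hy ↦ ?_, sub_self]
    rw [indicator_of_notMem (show y ∉ J from fun h ↦ hy (mem_Iic.2 (le_of_lt h.2))), zero_mul]
  have hAtL : Tendsto A (𝓝[>] (-lam)) (𝓝 0) := by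
    have := (hAc.tendsto (-lam)).mono_left (nhdsWithin_le_nhds (s := Ioi (-lam)))
    rwa [hA0] at this
  have hA'tL : Tendsto (fun x ↦ T - A' x) (𝓝[>] (-lam)) (𝓝 (T - A' (-lam))) :=
    ((continuous_const.sub hA'c).tendsto (-lam)).mono_left nhdsWithin_le_nhds
  have hAtR : Tendsto A (𝓝[<] lam) (𝓝 (A lam)) := (hAc.tendsto lam).mono_left nhdsWithin_le_nhds
  have hA'tR : Tendsto (fun x ↦ T - A' x) (𝓝[<] lam) (𝓝 0) := by
    have h1 : Tendsto (fun x ↦ T - A' x) (𝓝[<] lam) (𝓝 (T - A' lam)) :=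
      ((continuous_const.sub hA'c).tendsto lam).mono_left nhdsWithin_le_nhds
    rwa [hA'0] at h1
  -- the existing logarithmic coefficients of the non-governing solutions
  obtain ⟨⟨cv, hcv⟩, hv0L, -⟩ := prolate_singularEndpoint_mid_left hlam z (fun x hx ↦ (hsv x hx).1)
    (fun x hx ↦ (hsv x hx).2)
  obtain ⟨-, hu0L, -⟩ := prolate_singularEndpoint_mid_left hlam z (fun x hx ↦ (hsu x hx).1)
    (fun x hx ↦ (hsu x hx).2)
  obtain ⟨⟨cu, hcu⟩, hu0R, -⟩ := prolate_singularEndpoint_mid_right hlam z (fun x hx ↦ (hsu x hx).1)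
    (fun x hx ↦ (hsu x hx).2)
  obtain ⟨-, hv0R, -⟩ := prolate_singularEndpoint_mid_right hlam z (fun x hx ↦ (hsv x hx).1)
    (fun x hx ↦ (hsv x hx).2)
  -- boundary term at `(−λ)⁺`
  have hpkL : Tendsto (fun x ↦ pCoeff lam x * k x) (𝓝[>] (-lam)) (𝓝 0) := by
    have h1 := ((hcv.mul hAtL).add (hu0.mul hA'tL)).const_mul (-ω⁻¹)
    rw [mul_zero, zero_mul, zero_add, mul_zero] at h1
    refine h1.congr' ?_
    rw [← nhdsWithin_Ioo_eq_nhdsGT hll]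
    filter_upwards [self_mem_nhdsWithin] with x hx
    simp only [hkdef, indicator_of_mem (show x ∈ J from hx)]
    ring
  have hxhL : Tendsto (fun x ↦ ((x - -lam : ℝ) : ℂ) * h x) (𝓝[>] (-lam)) (𝓝 0) := by
    have h1 := ((hv0L.mul hAtL).add (hu0L.mul hA'tL)).const_mul (-ω⁻¹)
    rw [mul_zero, zero_mul, zero_add, mul_zero] at h1
    refine h1.congr' ?_
    rw [← nhdsWithin_Ioo_eq_nhdsGT hll]
    filter_upwards [self_mem_nhdsWithin] with x hx
    simp only [hhdef, indicator_of_mem (show x ∈ J from hx)]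
    ring
  have hBL : Tendsto (fun y ↦ θ y * (pCoeff lam y * k y) - pCoeff lam y * deriv θ y * h y)
      (𝓝[>] (-lam)) (𝓝 0) := by
    have h1 := tendsto_green_boundary_finite (lam := lam) θ (a := -lam) (by ring) nhdsWithin_le_nhds
      hpkL hxhL
    rw [mul_zero] at h1
    exact h1.congr fun y ↦ by ring
  -- boundary term at `λ⁻`
  have hpkR : Tendsto (fun x ↦ pCoeff lam x * k x) (𝓝[<] lam) (𝓝 0) := by
    have h1 := ((hv0.mul hAtR).add (hcu.mul hA'tR)).const_mul (-ω⁻¹)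
    rw [zero_mul, mul_zero, zero_add, mul_zero] at h1
    refine h1.congr' ?_
    rw [← nhdsWithin_Ioo_eq_nhdsLT hll]
    filter_upwards [self_mem_nhdsWithin] with x hx
    simp only [hkdef, indicator_of_mem (show x ∈ J from hx)]
    ring
  have hxhR : Tendsto (fun x ↦ ((x - lam : ℝ) : ℂ) * h x) (𝓝[<] lam) (𝓝 0) := by
    have h1 := (((hv0R.neg).mul hAtR).add ((hu0R.neg).mul hA'tR)).const_mul (-ω⁻¹)
    rw [neg_zero, zero_mul, mul_zero, zero_add, mul_zero] at h1
    refine h1.congr' ?_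
    rw [← nhdsWithin_Ioo_eq_nhdsLT hll]
    filter_upwards [self_mem_nhdsWithin] with x hx
    simp only [hhdef, indicator_of_mem (show x ∈ J from hx)]
    push_cast
    ring
  have hBR : Tendsto (fun y ↦ θ y * (pCoeff lam y * k y) - pCoeff lam y * deriv θ y * h y)
      (𝓝[<] lam) (𝓝 0) := by
    have h1 := tendsto_green_boundary_finite (lam := lam) θ (a := lam) rfl nhdsWithin_le_nhds hpkR hxhR
    rw [mul_zero] at h1
    exact h1.congr fun y ↦ by ring
  have hmain := weak_identity_component (lL := 𝓝[>] (-lam)) (lR := 𝓝[<] lam) isOpen_Ioo ordConnected_Ioo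
    hJ (fun Φ B hΦ hId hL hR' ↦ setIntegral_Ioo_eq_zero_of_tendsto hll hΦ hId hL hR')
    (fun x hx ↦ (hsu x hx).1) (fun x hx ↦ (hsu x hx).2) (fun x hx ↦ (hsv x hx).1)
    (fun x hx ↦ (hsv x hx).2) hW hω hu2 hv2 hF2 hFJ hh2 hhJ hh hk θ hBL hBR
  have e1 : ∫ x, prolateSchwartz lam θ x * (R f : ℝ → ℂ) x = ∫ x, prolateSchwartz lam θ x * h x :=
    integral_congr_ae (by filter_upwards [hae] with x hx; rw [hx])
  have e2 : ∫ x, θ x * (z * (R f : ℝ → ℂ) x + F x) = ∫ x, θ x * (z * h x + F x) :=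
    integral_congr_ae (by filter_upwards [hae] with x hx; rw [hx])
  rw [e1, e2, hmain]

end Components

/-! ## §6 Assembly: a compact right inverse of `W_max − z`, and compactness of every resolvent -/

section Assembly

/-- **A compact right inverse of `W_max − z`** (`Im z ≠ 0`): the sum `R₀` of the three component
Green operators is compact and satisfies `R₀ f ∈ dom W_max`, `W_max (R₀ f) − z R₀ f = f` for every
`f ∈ L²(ℝ)` (the three weak identities add up to `∫ (Wθ)(R₀ f) = ∫ θ (f + z R₀ f)`, `±λ` being
null, and the weak characterisation `exists_prolateMax_eq_of_forall_integral` of `dom W_max`).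
[cite: ConnesMoscovici2022, Thm 1.6 (iv) (= arXiv:2112.05500 Thm 2.6 (iv), chunk p0006:L79); ReedSimonIV1978, §XIII.14 Thm. XIII.64] -/
theorem exists_compact_rightInverse (hlam : 0 < lam) (hz : z.im ≠ 0) :
    ∃ R₀ : L2R →L[ℂ] L2R, IsCompactOperator R₀ ∧
      ∀ f : L2R, ∃ h : R₀ f ∈ (prolateMax lam).domain,
        (prolateMax lam ⟨R₀ f, h⟩ : L2R) - z • R₀ f = f := by
  obtain ⟨R₁, hR₁c, hR₁⟩ := exists_greenOp_Iio hlam z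
  obtain ⟨R₂, hR₂c, hR₂⟩ := exists_greenOp_Ioo hlam hz
  obtain ⟨R₃, hR₃c, hR₃⟩ := exists_greenOp_Ioi hlam z
  have hc : IsCompactOperator (R₁ + R₂ + R₃ : L2R →L[ℂ] L2R) := by
    have h := (hR₁c.add hR₂c).add hR₃c
    have hfun : ((⇑R₁ + ⇑R₂) + ⇑R₃ : L2R → L2R) = ⇑(R₁ + R₂ + R₃) := by ext f; simp
    rwa [hfun] at h
  refine ⟨R₁ + R₂ + R₃, hc, fun f ↦ ?_⟩
  set G : L2R := (R₁ + R₂ + R₃) f with hGdef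
  -- the weak identity for the sum
  have key : ∀ θ : 𝓢(ℝ, ℂ), ∫ x, prolateSchwartz lam θ x * G x = ∫ x, θ x * (f + z • G : L2R) x := by
    intro θ
    have hG : (G : ℝ → ℂ) =ᵐ[volume] fun x ↦ (R₁ f : ℝ → ℂ) x + (R₂ f : ℝ → ℂ) x + (R₃ f : ℝ → ℂ) x := by
      have e : G = R₁ f + R₂ f + R₃ f := by simp [hGdef]
      rw [e]
      filter_upwards [Lp.coeFn_add (R₁ f + R₂ f) (R₃ f), Lp.coeFn_add (R₁ f) (R₂ f)] with x h1 h2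
      rw [h1, Pi.add_apply, h2, Pi.add_apply]
    have hH : ((f + z • G : L2R) : ℝ → ℂ) =ᵐ[volume] fun x ↦ (f : ℝ → ℂ) x + z * (G : ℝ → ℂ) x := by
      filter_upwards [Lp.coeFn_add f (z • G), Lp.coeFn_smul z G] with x h1 h2
      rw [h1, Pi.add_apply, h2, Pi.smul_apply, smul_eq_mul]
    -- `1_{(−∞,−λ)} + 1_{(−λ,λ)} + 1_{(λ,∞)} = 1` a.e.
    have hind : ∀ᵐ x ∂volume, (Iio (-lam)).indicator (f : ℝ → ℂ) x +
        (Ioo (-lam) lam).indicator (f : ℝ → ℂ) x + (Ioi lam).indicator (f : ℝ → ℂ) x = f x := by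
      have hnull : (({lam, -lam} : Set ℝ))ᶜ ∈ ae (volume : Measure ℝ) :=
        compl_mem_ae_iff.2 ((Set.toFinite _).measure_zero _)
      filter_upwards [hnull] with x hx
      simp only [mem_compl_iff, mem_insert_iff, mem_singleton_iff, not_or] at hx
      rcases lt_or_gt_of_ne hx.2 with h1 | h1
      · rw [indicator_of_mem (show x ∈ Iio (-lam) from h1),
          indicator_of_notMem (show x ∉ Ioo (-lam) lam from fun h ↦ lt_asymm h1 h.1),
          indicator_of_notMem (show x ∉ Ioi lam from fun h ↦ by
            have : (0 : ℝ) < lam := hlam; exact absurd (lt_trans h1 (by linarith : -lam < lam)) (lt_asymm h))]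
        ring
      · rcases lt_or_gt_of_ne hx.1 with h2 | h2
        · rw [indicator_of_notMem (show x ∉ Iio (-lam) from fun h ↦ lt_asymm h1 h),
            indicator_of_mem (show x ∈ Ioo (-lam) lam from ⟨h1, h2⟩),
            indicator_of_notMem (show x ∉ Ioi lam from fun h ↦ lt_asymm h2 h)]
          ring
        · rw [indicator_of_notMem (show x ∉ Iio (-lam) from fun h ↦ lt_asymm h1 h),
            indicator_of_notMem (show x ∉ Ioo (-lam) lam from fun h ↦ lt_asymm h2 h.2),
            indicator_of_mem (show x ∈ Ioi lam from h2)]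
          ring
    -- integrability of the pieces
    have hiW : ∀ S : L2R →L[ℂ] L2R, Integrable (fun x ↦ prolateSchwartz lam θ x * (S f : ℝ → ℂ) x) :=
      fun S ↦ ((prolateSchwartz lam θ).memLp 2 volume).integrable_mul (Lp.memLp (S f))
    have hiθ : ∀ (S : L2R →L[ℂ] L2R) {I : Set ℝ}, MeasurableSet I →
        Integrable (fun x ↦ θ x * (z * (S f : ℝ → ℂ) x + I.indicator (f : ℝ → ℂ) x)) :=
      fun S I hI ↦ (θ.memLp 2 volume).integrable_mul
        (((Lp.memLp (S f)).const_mul z).add ((Lp.memLp f).indicator hI))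
    calc ∫ x, prolateSchwartz lam θ x * G x
        = ∫ x, (prolateSchwartz lam θ x * (R₁ f : ℝ → ℂ) x + prolateSchwartz lam θ x * (R₂ f : ℝ → ℂ) x)
            + prolateSchwartz lam θ x * (R₃ f : ℝ → ℂ) x := by
          refine integral_congr_ae ?_
          filter_upwards [hG] with x hx
          rw [hx]; ring
      _ = (∫ x, θ x * (z * (R₁ f : ℝ → ℂ) x + (Iio (-lam)).indicator (f : ℝ → ℂ) x))
            + (∫ x, θ x * (z * (R₂ f : ℝ → ℂ) x + (Ioo (-lam) lam).indicator (f : ℝ → ℂ) x))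
            + ∫ x, θ x * (z * (R₃ f : ℝ → ℂ) x + (Ioi lam).indicator (f : ℝ → ℂ) x) := by
          have h12 : Integrable (fun x ↦ prolateSchwartz lam θ x * (R₁ f : ℝ → ℂ) x
              + prolateSchwartz lam θ x * (R₂ f : ℝ → ℂ) x) := (hiW R₁).add (hiW R₂)
          rw [integral_add h12 (hiW R₃), integral_add (hiW R₁) (hiW R₂),
            hR₁ f θ, hR₂ f θ, hR₃ f θ]
      _ = ∫ x, (θ x * (z * (R₁ f : ℝ → ℂ) x + (Iio (-lam)).indicator (f : ℝ → ℂ) x)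
            + θ x * (z * (R₂ f : ℝ → ℂ) x + (Ioo (-lam) lam).indicator (f : ℝ → ℂ) x))
            + θ x * (z * (R₃ f : ℝ → ℂ) x + (Ioi lam).indicator (f : ℝ → ℂ) x) := by
          have h12 : Integrable (fun x ↦
              θ x * (z * (R₁ f : ℝ → ℂ) x + (Iio (-lam)).indicator (f : ℝ → ℂ) x)
              + θ x * (z * (R₂ f : ℝ → ℂ) x + (Ioo (-lam) lam).indicator (f : ℝ → ℂ) x)) :=
            (hiθ R₁ measurableSet_Iio).add (hiθ R₂ measurableSet_Ioo)
          rw [integral_add h12 (hiθ R₃ measurableSet_Ioi), integral_add (hiθ R₁ measurableSet_Iio)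
            (hiθ R₂ measurableSet_Ioo)]
      _ = ∫ x, θ x * (f + z • G : L2R) x := by
          refine integral_congr_ae ?_
          filter_upwards [hG, hH, hind] with x hx hHx hix
          rw [hHx, hx, ← hix]; ring
  obtain ⟨hG, hEq⟩ := exists_prolateMax_eq_of_forall_integral lam key
  refine ⟨hG, ?_⟩
  rw [hEq, add_sub_cancel_right]

/-- **Connes–Moscovici 2022, Thm 1.6 (iv) — operator half.**  For `λ > 0`, EVERY self-adjoint
restriction `W ≤ W_max` of the maximal prolate operator (in particular the realisation `W_sa` of the
printed boundary conditions, given clause (i)) has COMPACT RESOLVENT: `(W − z)⁻¹` is a compact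
operator for every non-real `z`.  (Hence — tree, `exists_hilbertBasis_nat_eigenvectors_of_compact_resolvent`
— `L²(ℝ)` has an orthonormal basis of eigenvectors of `W` with real eigenvalues `|μ_n| → ∞`:
"the spectrum of `W_sa` is discrete"; the clause "unbounded on both sides" is the separate sign
computation of Lemma 6.3.)  Proof: compact right inverse of `W_max − z`
(`exists_compact_rightInverse`) + `dim ker(W_max − z) = 4` (`finrank_eigenspace_prolateMax`) +
the abstract reduction `isCompactOperator_resolvent_of_rightInverse_of_finrank`.
[cite: ConnesMoscovici2022, Thm 1.6 (iv) (= arXiv:2112.05500 Thm 2.6 (iv), held chunk p0006:L79); ReedSimonIV1978, §XIII.14 Thm. XIII.64] -/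
theorem isCompactOperator_resolvent_of_le_prolateMax (hlam : 0 < lam) {W : L2R →ₗ.[ℂ] L2R}
    (hle : W ≤ prolateMax lam) (hW : IsSelfAdjoint W) {z : ℂ} (hz : z.im ≠ 0) :
    IsCompactOperator (resolvent hW hz) := by
  obtain ⟨R₀, hR₀, hinv⟩ := exists_compact_rightInverse (z := z) hlam hz
  exact isCompactOperator_resolvent_of_rightInverse_of_finrank hle hW hz hR₀ hinv (n := 4)
    (by norm_num) (finrank_eigenspace_prolateMax hlam z)

/-- **Thm 1.6 (iv), operator half, for the realisations of the tree's boundary conditions**: if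
`W` realises the Connes–Moscovici boundary conditions (`IsProlateSA`) and is self-adjoint
(clause (i)), its resolvent is compact.
[cite: ConnesMoscovici2022, Thm 1.6 (i), (iv) (= arXiv:2112.05500 Thm 2.6, held chunk p0006:L74–L79)] -/
theorem isCompactOperator_resolvent_of_isProlateSA (hlam : 0 < lam) {W : L2R →ₗ.[ℂ] L2R}
    (hWsa : IsProlateSA lam W) (hW : IsSelfAdjoint W) {z : ℂ} (hz : z.im ≠ 0) :
    IsCompactOperator (resolvent hW hz) :=
  isCompactOperator_resolvent_of_le_prolateMax hlam hWsa.1 hW hz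

end Assembly

/-! ## §7 Clause (iv) of Theorem 1.6, modulo clause (i) -/

section Spectrum

/-- **Every self-adjoint restriction of `W_max` has discrete spectrum, unbounded on both sides**
(`λ > 0`): an orthonormal eigenbasis with real eigenvalues `|μ_n| → ∞`, `{μ_n}` bounded neither
above nor below — compact resolvent (`isCompactOperator_resolvent_of_le_prolateMax`, at `z = i`)
fed into the tree's `hasDiscreteSpectrumUnboundedBothSides_of_compact_resolvent` (rh-crit-cc-t12:
eigenbasis from a compact resolvent + the two-sided Rayleigh-quotient sign computation on the core,
which every self-adjoint `W ≤ W_max` contains by `prolateCore_le_of_isSelfAdjoint`).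
[cite: ConnesMoscovici2022, Thm 1.6 (iv) (= arXiv:2112.05500 Thm 2.6 (iv), held chunk p0006:L79)] -/
theorem hasDiscreteSpectrumUnboundedBothSides_of_le_prolateMax (hlam : 0 < lam)
    {W : L2R →ₗ.[ℂ] L2R} (hle : W ≤ prolateMax lam) (hW : IsSelfAdjoint W) :
    HasDiscreteSpectrumUnboundedBothSides W :=
  hasDiscreteSpectrumUnboundedBothSides_of_compact_resolvent lam hlam hW
    (prolateCore_le_of_isSelfAdjoint lam hW hle) (z := Complex.I) (by simp)
    (isCompactOperator_resolvent_of_le_prolateMax hlam hle hW (by simp))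

/-- **[ConnesMoscovici2022, Thm 1.6 (iv)] for the realisations of the printed boundary conditions,
modulo clause (i)**: if `IsProlateSA λ W` and `W` is self-adjoint, the spectrum of `W` is discrete
and unbounded on both sides. [cite: ConnesMoscovici2022, Thm 1.6 (i), (iv) (= arXiv:2112.05500 Thm 2.6, held chunk p0006:L76–L79)] -/
theorem hasDiscreteSpectrumUnboundedBothSides_of_isProlateSA_of_isSelfAdjoint (hlam : 0 < lam)
    {W : L2R →ₗ.[ℂ] L2R} (hWsa : IsProlateSA lam W) (hW : IsSelfAdjoint W) :
    HasDiscreteSpectrumUnboundedBothSides W :=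
  hasDiscreteSpectrumUnboundedBothSides_of_le_prolateMax hlam hWsa.1 hW

/-- **[ConnesMoscovici2022, Thm 1.6 (iv)] for THE operator `W_sa = prolateSA λ`, modulo clause (i)**
— exactly the input `hspec` of the tree's assembly `CM22_thm_1_6_of` / `CM22_thm_1_6_of_struct`
(`UVProlateThm16Assembly.lean`), now reduced to `hSA`.
[cite: ConnesMoscovici2022, Thm 1.6 (i), (iv) (= arXiv:2112.05500 Thm 2.6, held chunk p0006:L76–L79)] -/
theorem hasDiscreteSpectrumUnboundedBothSides_prolateSA (hlam : 0 < lam)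
    (hSA : IsSelfAdjoint (prolateSA lam hlam)) :
    HasDiscreteSpectrumUnboundedBothSides (prolateSA lam hlam) :=
  hasDiscreteSpectrumUnboundedBothSides_of_isProlateSA_of_isSelfAdjoint hlam
    (isProlateSA_prolateSA hlam) hSA

end Spectrum

end Literature.NumberTheory.ConnesMoscovici2022

end
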